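import Literature.AlgebraicGeometry.Frobenioids.Cor411iiBiratApexWeak
import Literature.AlgebraicGeometry.Frobenioids.Thm42SubWeak
import HarnessLib

/-!
# Frobenioids I, Corollary 4.11 (ii) AS TYPED over the WEAK setting of the proof of Theorem 4.2
# (`FrdI.T42.SettingWeak`) — the junction of the clause-threaded weak chain with the structure twin

Mochizuki, *The geometry of Frobenioids I: the general theory*, Kyushu J. Math. **62** (2008) 293–400, Cor. 4.11 (ii)
p. 91, proof pp. 92–94 [cite: MochizukiFrdI2008, Cor. 4.11 (ii) p.91]; the setting of the proof of Thm. 4.2 after its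
reductions, p. 78 ll. 28–46 [cite: MochizukiFrdI2008, Thm. 4.2 p.78].

PROOF-ONLY file (cell abc-iut, layer L1, node `FrdI:Cor4.11(ii)`; seat abc-iut-L1-t12, row «C411ii-WEAK», junction).
This seat's weak Cor. 4.11 (ii) chain threads the clauses of the setting as explicit binders
(`FrdI.T42.exists_base_equivalence_inst_of_clauses_weak` / `cor411ii_inst_of_clauses_weak`, `Cor411iiBiratApexWeak.lean`,
p440071); seat abc-iut-L1-t14's block (Σ) of the Thm. 4.9 / Cor. 4.11 (iii)(iv) weak programme introduced the
structure twin `FrdI.T42.SettingWeak` (`Thm42SubWeak.lean`, p442381: `T42.Setting` verbatim with `perfFactorial₁/₂`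
weakened to `Objectwise IsPerfFactorialWeak Φ_i`).  THIS FILE is the two-line junction, so that the (iii)(iv) assembly
(block (T3)) can consume the (ii) base square over `S : SettingWeak F₁ F₂ Ψ` BY NAME exactly as the strong assembly
consumes `exists_base_equivalence_inst_of_setting` / `cor411ii_inst_of_setting` (`Cor411iiBiratApexSetting.lean`, seat
abc-iut-L1-d6) over `S : Setting F₁ F₂ Ψ`:
* `FrdI.T42.exists_base_equivalence_inst_of_settingWeak` — the base square `Ψ^Base` under `Ψ`, given in addition
  `HasBiratSquares`, the Frobenioid structures of the birationalizations (Prop. 4.4 (ii)), bases of FSMFF-type Div-slim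
  relative to the non-dilating `Φ_i`, and "`Ψ`, `Ψ⁻¹` preserve primary pre-steps" (Thm. 4.2 (i));
* `FrdI.T42.cor411ii_inst_of_settingWeak` — the typed `Cor411ii` over `SettingWeak`.
Weak twins of `exists_base_equivalence_inst_of_setting` / `cor411ii_inst_of_setting`; the printed case `Setting → SettingWeak`
is seat abc-iut-L1-t14's `Setting.weak` (its companion file), equivalently the `example` of `Cor411iiBiratApexWeak.lean`.
No new definitions; no landed declaration touched; nothing of the paper restated or strengthened; nothing here is specific to
the abc programme.  HONEST FRAMING: classical [FrdI] §4; nothing here bears on [IUTchIII] Cor. 3.12.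
-/

namespace Literature.AlgebraicGeometry.Frobenioids

open CategoryTheory Opposite

namespace FrdI.T42

open PreFrobenioid

universe w v v' u u'

variable {D₁ : Type u} [Category.{v} D₁] {Φ₁ : D₁ᵒᵖ ⥤ CommMonCat.{w}} {C₁ : Type u'} [Category.{v'} C₁]
  {D₂ : Type u} [Category.{v} D₂] {Φ₂ : D₂ᵒᵖ ⥤ CommMonCat.{w}} {C₂ : Type u'} [Category.{v'} C₂]
  {F₁ : C₁ ⥤ ElemFrobenioid Φ₁} {F₂ : C₂ ⥤ ElemFrobenioid Φ₂} {Ψ : C₁ ≌ C₂}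

/-- **The base square of [FrdI] Cor. 4.11 (ii) over `FrdI.T42.SettingWeak`** (Frobenioids of perfect and isotropic
type, `Φ_i` WEAKLY perf-factorial, the conclusions of Thm. 3.4 (ii)(iii) for `Ψ`, `Ψ⁻¹`), given in addition
`HasBiratSquares` and the Frobenioid structures of the birationalizations (Prop. 4.4 (ii)), bases of FSMFF-type Div-slim
relative to the non-dilating `Φ_i`, and "`Ψ`, `Ψ⁻¹` preserve primary pre-steps" (Thm. 4.2 (i)) — the fields of `S` fed to
`exists_base_equivalence_inst_of_clauses_weak`.  Weak twin of `exists_base_equivalence_inst_of_setting`.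
[cite: MochizukiFrdI2008, Cor. 4.11 (ii) p.91] -/
theorem exists_base_equivalence_inst_of_settingWeak (S : SettingWeak F₁ F₂ Ψ)
    (hsq₁ : HasBiratSquares F₁) (hsq₂ : HasBiratSquares F₂)
    (hB₁ : IsFrobenioid (Birat.toElemZero S.isFrobenioid₁ hsq₁))
    (hB₂ : IsFrobenioid (Birat.toElemZero S.isFrobenioid₂ hsq₂))
    (hD₁ : IsOfFSMFFType D₁) (hD₂ : IsOfFSMFFType D₂)
    (hnd₁ : IsNonDilatingOn Φ₁) (hnd₂ : IsNonDilatingOn Φ₂)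
    (hds₁ : (PreFrobenioidData.ofFunctor Φ₁ F₁).IsDivSlim) (hds₂ : (PreFrobenioidData.ofFunctor Φ₂ F₂).IsDivSlim)
    (hprim : ∀ ⦃X Y : C₁⦄ (φ : X ⟶ Y), IsPrimaryPreStep F₁ φ → IsPrimaryPreStep F₂ (Ψ.functor.map φ))
    (hprim' : ∀ ⦃X Y : C₂⦄ (φ : X ⟶ Y), IsPrimaryPreStep F₂ φ → IsPrimaryPreStep F₁ (Ψ.inverse.map φ)) :
    ∃ ΨBase : D₁ ⥤ D₂, ΨBase.IsEquivalence ∧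
      OneCommutes Ψ.functor (PreFrobenioidData.ofFunctor Φ₂ F₂).base (PreFrobenioidData.ofFunctor Φ₁ F₁).base
        ΨBase :=
  exists_base_equivalence_inst_of_clauses_weak S.isFrobenioid₁ S.isFrobenioid₂ S.perfect₁ S.perfect₂ S.isotropic₁
    S.isotropic₂ S.perfFactorial₁ S.perfFactorial₂ S.preStep_map S.preStep_inv S.frobeniusType_map S.frobeniusType_inv
    S.degFr_map S.pullback_map S.pullback_inv hsq₁ hsq₂ hB₁ hB₂ hD₁ hD₂ hnd₁ hnd₂ hds₁ hds₂ hprim hprim'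

/-- **[FrdI] Cor. 4.11 (ii) AS TYPED over `FrdI.T42.SettingWeak`** — `exists_base_equivalence_inst_of_settingWeak` followed
by the `1`-uniqueness and rigidity theorems (`cor411ii_of_exists_base_equivalence'`).  Weak twin of
`cor411ii_inst_of_setting`. [cite: MochizukiFrdI2008, Cor. 4.11 (ii) p.91] -/
theorem cor411ii_inst_of_settingWeak (S : SettingWeak F₁ F₂ Ψ)
    (hsq₁ : HasBiratSquares F₁) (hsq₂ : HasBiratSquares F₂)
    (hB₁ : IsFrobenioid (Birat.toElemZero S.isFrobenioid₁ hsq₁))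
    (hB₂ : IsFrobenioid (Birat.toElemZero S.isFrobenioid₂ hsq₂))
    (hD₁ : IsOfFSMFFType D₁) (hD₂ : IsOfFSMFFType D₂)
    (hnd₁ : IsNonDilatingOn Φ₁) (hnd₂ : IsNonDilatingOn Φ₂)
    (hds₁ : (PreFrobenioidData.ofFunctor Φ₁ F₁).IsDivSlim) (hds₂ : (PreFrobenioidData.ofFunctor Φ₂ F₂).IsDivSlim)
    (hprim : ∀ ⦃X Y : C₁⦄ (φ : X ⟶ Y), IsPrimaryPreStep F₁ φ → IsPrimaryPreStep F₂ (Ψ.functor.map φ))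
    (hprim' : ∀ ⦃X Y : C₂⦄ (φ : X ⟶ Y), IsPrimaryPreStep F₂ φ → IsPrimaryPreStep F₁ (Ψ.inverse.map φ)) :
    (PreFrobenioidData.ofFunctor Φ₁ F₁).Cor411ii (PreFrobenioidData.ofFunctor Φ₂ F₂) Ψ :=
  cor411ii_of_exists_base_equivalence' F₁ F₂ Ψ S.isFrobenioid₁ S.isFrobenioid₂
    (exists_base_equivalence_inst_of_settingWeak S hsq₁ hsq₂ hB₁ hB₂ hD₁ hD₂ hnd₁ hnd₂ hds₁ hds₂ hprim hprim')

/-- The printed case: `FrdI.T42.Setting` feeds the `SettingWeak`-typed theorem through the anonymous constructor with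
`IsPerfFactorial.weak` in the two monoid fields (field order and types of the structure twin certified by elaboration).
[cite: MochizukiFrdI2008, Cor. 4.11 (ii) p.91] -/
example (S : Setting F₁ F₂ Ψ)
    (hsq₁ : HasBiratSquares F₁) (hsq₂ : HasBiratSquares F₂)
    (hB₁ : IsFrobenioid (Birat.toElemZero S.isFrobenioid₁ hsq₁))
    (hB₂ : IsFrobenioid (Birat.toElemZero S.isFrobenioid₂ hsq₂))
    (hD₁ : IsOfFSMFFType D₁) (hD₂ : IsOfFSMFFType D₂)
    (hnd₁ : IsNonDilatingOn Φ₁) (hnd₂ : IsNonDilatingOn Φ₂)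
    (hds₁ : (PreFrobenioidData.ofFunctor Φ₁ F₁).IsDivSlim) (hds₂ : (PreFrobenioidData.ofFunctor Φ₂ F₂).IsDivSlim)
    (hprim : ∀ ⦃X Y : C₁⦄ (φ : X ⟶ Y), IsPrimaryPreStep F₁ φ → IsPrimaryPreStep F₂ (Ψ.functor.map φ))
    (hprim' : ∀ ⦃X Y : C₂⦄ (φ : X ⟶ Y), IsPrimaryPreStep F₂ φ → IsPrimaryPreStep F₁ (Ψ.inverse.map φ)) :
    (PreFrobenioidData.ofFunctor Φ₁ F₁).Cor411ii (PreFrobenioidData.ofFunctor Φ₂ F₂) Ψ :=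
  cor411ii_inst_of_settingWeak
    ⟨S.isFrobenioid₁, S.isFrobenioid₂, S.perfect₁, S.perfect₂, S.isotropic₁, S.isotropic₂,
      fun X => (S.perfFactorial₁ X).weak, fun X => (S.perfFactorial₂ X).weak, S.preStep_map, S.preStep_inv,
      S.step_map, S.step_inv, S.frobeniusType_map, S.frobeniusType_inv, S.degFr_map, S.pullback_map, S.pullback_inv⟩
    hsq₁ hsq₂ hB₁ hB₂ hD₁ hD₂ hnd₁ hnd₂ hds₁ hds₂ hprim hprim'

end FrdI.T42

end Literature.AlgebraicGeometry.Frobenioids
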